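import Summits.SmoothPoincare4.SmoothPoincare4.Theorems.SblfDescentRungOneHelperFoldNFFamily
import Summits.SmoothPoincare4.SmoothPoincare4.Theorems.SblfDescentRungOneHelperFoldNFDescend
import Literature.Topology.FourManifolds.SimplifiedBrokenLefschetzRoundSlicesIndex
import Literature.Topology.FourManifolds.SimplifiedBrokenLefschetzRoundCircle
import Literature.Topology.FourManifolds.GenericFoldChart
import HarnessLib

/-!
# The page Hessians of the height along the round circle, in a fold chart

Helper `helper_foldNF_pageHessianAt` of stub `helper_sliceGluing_foldNormalForm` (the
`S¹`-parametric fold normal form of the round circle), line `Sketch`, crux `SblfDescent.RungOne`.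

(Crux item stmt-SmoothPoincare4-18531; skeleton `Cruxes/RungOne/Lines/Sketch.lean`.)

Let `f : X → S²` be a genus-one Lefschetz-free SBLF with equatorial round image, `v = (0, 0, v₂)`
the torus-side pole, `e` the round circle by longitude, `ν₀ : S¹ × ℝ³ ↪ X` a tube about it and
`g (t, x) = ⟪v, f (ν₀ (circlePt t, x))⟫` the height family (`helper_foldNF_family`).  We compute
the PAGE HESSIAN `H_t (a, b) = ∂ₓ∂ₓ g (t, 0) (a, b)` in a fold chart `(φ, ψ)` centred at the round
point `e (circlePt t)` (Hayano 2011, Def. 2.1 (4)): with `Λ = ⟪v, ·⟫ ∘ ψ⁻¹`, `N` the fold normal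
form and `w = φ ∘ ν₀ ∘ (circlePt × id)`, `g = Λ ∘ N ∘ w` near `(t, 0)`; `Λ ∘ N` is critical at
the axis point `0` with Hessian `λ · 2 (dx₁² + dx₂² - dx₃²)`, `λ = ∂ₛΛ(0) ≠ 0` (the axis of the
chart goes to the equator, to second order; `∂ₛψ⁻¹(0)` is transverse to the equator), so by the
second-order chain rule `H_t (a, b) = λ · 2 B (P a, P b)` with `B` the standard index-one form
and `P a` the last three chart coordinates of `dw (0, a)` — an INJECTIVE map, because `dw` is
injective and carries the parameter direction onto the axis.  At `t = 0` (a round point of the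
meridian slice `y₁ = 0`) the tree's `mul_fderiv_symm_pos_of_fold_chart` gives `λ > 0`: the
torus side `⟪y, v⟫ > 0` is the side `s > 0` of the fold.  Consequences (nondegeneracy, index `1`
for all `t`) are drawn in the next layer.

## References

* K. Hayano, *On genus-1 simplified broken Lefschetz fibrations*, Algebr. Geom. Topol. 11
  (2011), Def. 2.1 (4). [Hayano2011]
* J. Milnor, *Morse theory* (1963), §2. [Milnor1963]
* R. İ. Baykur, S. Kamada, *Classification of broken Lefschetz fibrations with small fiber
  genera*, J. Math. Soc. Japan 67 (2015), §2. [BaykurKamada2015]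
-/

set_option linter.dupNamespace false

noncomputable section

open scoped Manifold ContDiff Topology RealInnerProductSpace
open Set Function Filter Metric Literature.Topology.FourManifolds
  Literature.AlgebraicTopology.SingularHomology
  Literature.Topology.FourManifolds.IsSimplifiedBrokenLefschetzFibration

namespace Summit.SmoothPoincare4.SmoothPoincare4.Cruxes.RungOne.Sketch

/-- Local notation: `𝔼 n` is the model Euclidean space `EuclideanSpace ℝ (Fin n)`. -/
local notation "𝔼 " n:arg => EuclideanSpace ℝ (Fin n)

/-- Local notation: `𝕊²`, the unit sphere of `ℝ³`. -/
local notation "𝕊²" => (Metric.sphere (0 : EuclideanSpace ℝ (Fin 3)) (1 : ℝ))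

/-- Local notation: the indefinite fold normal form `(t, x₁, x₂, x₃) ↦ (t, x₁² + x₂² - x₃²)`. -/
local notation "foldNF" => (fun v : EuclideanSpace ℝ (Fin 4) =>
    (WithLp.toLp 2 ![v 0, v 1 ^ 2 + v 2 ^ 2 - v 3 ^ 2] : EuclideanSpace ℝ (Fin 2)))

attribute [local instance] Literature.Topology.FourManifolds.fact_finrank_euclideanSpace_succ

/-! ### The transverse derivative of the base germ is transverse to the equator -/

/-- **`∂ₛψ⁻¹(0)` leaves the equator.**  For a `C²` germ `Γ : ℝ² → S² ⊆ ℝ³` at `0` carrying the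
axis into the equator `{y₂ = 0}`, with injective differential at `0`: the second coordinate
direction is carried OFF the equator to first order, `∂₁Γ₂(0) ≠ 0` (the horizontal tangent line
of `S²` at `Γ 0` is already spanned by `∂₀Γ(0)`). [folklore] -/
theorem fderiv_single_one_two_ne_zero {Γ : EuclideanSpace ℝ (Fin 2) → EuclideanSpace ℝ (Fin 3)}
    (hΓ : ContDiffAt ℝ 2 Γ 0) (hS : ∀ᶠ y in 𝓝 (0 : EuclideanSpace ℝ (Fin 2)), ‖Γ y‖ = 1)
    (hE : ∀ᶠ t in 𝓝 (0 : ℝ), Γ (t • EuclideanSpace.single (0 : Fin 2) (1 : ℝ)) 2 = 0)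
    (hinj : Injective (fderiv ℝ Γ 0)) :
    fderiv ℝ Γ 0 (EuclideanSpace.single (1 : Fin 2) (1 : ℝ)) 2 ≠ 0 := by
  set e₀ : EuclideanSpace ℝ (Fin 2) := EuclideanSpace.single (0 : Fin 2) (1 : ℝ) with he₀
  set e₁ : EuclideanSpace ℝ (Fin 2) := EuclideanSpace.single (1 : Fin 2) (1 : ℝ) with he₁
  set p : EuclideanSpace ℝ (Fin 3) := fderiv ℝ Γ 0 e₁ with hp
  intro hp2
  have hd0 : DifferentiableAt ℝ Γ 0 := hΓ.differentiableAt (by simp)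
  have htan := SphereGerm.inner_fderiv_eq_zero hS hd0 e₁
  have h2 := SphereGerm.apply_zero_two hE
  rw [BandFoliation.inner_eq_three, ← hp, hp2, mul_zero, add_zero] at htan
  have hnorm : ‖Γ 0‖ = 1 := hS.self_of_nhds
  have hsq : Γ 0 0 ^ 2 + Γ 0 1 ^ 2 = 1 := by
    have h1 : ‖Γ 0‖ ^ 2 = 1 := by rw [hnorm, one_pow]
    rw [← real_inner_self_eq_norm_sq, BandFoliation.inner_eq_three, h2] at h1
    nlinarith [h1]
  obtain ⟨d, hd, hw⟩ := SphereGerm.fderiv_single_zero_eq_smul hΓ hS hE hinj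
  set c : ℝ := -(Γ 0 1) * p 0 + Γ 0 0 * p 1 with hc
  have hp0 : p 0 = c * (-(Γ 0 1)) := by
    rw [hc]; linear_combination Γ 0 0 * htan - p 0 * hsq
  have hp1 : p 1 = c * Γ 0 0 := by
    rw [hc]; linear_combination Γ 0 1 * htan - p 1 * hsq
  -- `p = (c/d) ∂₀Γ(0)`, contradicting injectivity
  have hpe : p = (c / d) • fderiv ℝ Γ 0 e₀ := by
    rw [hw, smul_smul, div_mul_cancel₀ _ hd]
    ext i
    fin_cases i
    · simp [hp0]
    · simp [hp1, mul_comm]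
    · simpa using hp2
  have hzero : fderiv ℝ Γ 0 (e₁ - (c / d) • e₀) = 0 := by
    rw [map_sub, map_smul, ← hp, hpe, sub_self]
  have heq : e₁ - (c / d) • e₀ = 0 := hinj (by rw [hzero, map_zero])
  have := congrArg (fun z : EuclideanSpace ℝ (Fin 2) => z 1) heq
  simp [he₀, he₁] at this

/-! ### Linear algebra: the page frame read off an injective differential -/

/-- **The page frame is injective.**  Let `D : ℝ × ℝ³ →L ℝ⁴` be injective and carry the
parameter direction into the axis (`D (τ, 0)` has vanishing last three coordinates).  Then
`a ↦` (last three coordinates of `D (0, a)`) is injective. [folklore] -/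
theorem injective_fibrePart_comp_inr {D : (ℝ × 𝔼 3) →L[ℝ] 𝔼 4} (hD : Injective D)
    (haxis : ∀ (τ : ℝ) (i : Fin 3), D (τ, 0) i.succ = 0) :
    Injective (fibrePart.comp (D.comp (ContinuousLinearMap.inr ℝ ℝ (𝔼 3)))) := by
  intro a b hab
  rw [← sub_eq_zero] at hab ⊢
  rw [← map_sub] at hab
  set x : 𝔼 3 := a - b with hx
  -- `D (0, x)` lies on the axis, which is spanned by `D (1, 0)`
  have hx123 : ∀ i : Fin 3, D ((0 : ℝ), x) i.succ = 0 := fun i => by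
    have := congrArg (fun z : 𝔼 3 => z i) hab
    simpa [fibrePart_apply] using this
  have h10 : D ((1 : ℝ), (0 : 𝔼 3)) 0 ≠ 0 := by
    intro h0
    have hz : D ((1 : ℝ), (0 : 𝔼 3)) = 0 := by
      ext i
      refine Fin.cases ?_ (fun j => ?_) i
      · simpa using h0
      · simpa using haxis 1 j
    have := hD (hz.trans (map_zero D).symm)
    simp at this
  set α : ℝ := D ((0 : ℝ), x) 0 / D ((1 : ℝ), (0 : 𝔼 3)) 0 with hα
  have hkey : D ((0 : ℝ), x) = D ((α : ℝ), (0 : 𝔼 3)) := by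
    have hsm : ((α : ℝ), (0 : 𝔼 3)) = α • ((1 : ℝ), (0 : 𝔼 3)) := by simp
    rw [hsm, map_smul]
    ext i
    refine Fin.cases ?_ (fun j => ?_) i
    · simp only [PiLp.smul_apply, smul_eq_mul]
      rw [hα, div_mul_cancel₀ _ h10]
    · simp only [PiLp.smul_apply, smul_eq_mul]
      rw [hx123 j, haxis 1 j, mul_zero]
  have := hD hkey
  simp only [Prod.mk.injEq] at this
  exact this.2

/-! ### The page Hessian in a fold chart -/

/-- **The page Hessians of the height along the round circle, in a fold chart.**  For every
parameter `t₀` there are `c ≠ 0` and an injective linear `P : ℝ³ → ℝ³` with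
`∂ₓ∂ₓ g (t₀, 0) (a, b) = c · 2 (P a · P b)_{(+,+,-)}`, where
`g (t, x) = ⟪v, f (ν₀ (circlePt t, x))⟫`; and `c > 0` for `t₀ = 0` (the torus side is the side
`s > 0` of the fold).  [`c = ∂ₛ(⟪v, ·⟫ ∘ ψ⁻¹)(0)` and `P` = last three chart coordinates of the
page derivative, for a fold chart `(φ, ψ)` centred at `e (circlePt t₀)`.]
[cite: Hayano2011, Def. 2.1 (4)] [cite: Milnor1963, §2] -/
theorem helper_foldNF_pageHessianAt : ∀ (X : Type) [TopologicalSpace X] [T2Space X] [SecondCountableTopology X] [CompactSpace X] [ChartedSpace (𝔼 4) X] [IsManifold (𝓡 4) ∞ X] (o : SmoothOrientation (𝓡 4) X) (f : X → 𝕊²), IsSimplifiedBrokenLefschetzFibration o f ∅ 0 → f '' ({p : X | ¬ Surjective (mfderiv (𝓡 4) (𝓡 2) f p)} \ (↑(∅ : Finset X) : Set X)) = sphereEquator 1 → ∀ (v : 𝕊²), (v : 𝔼 3) 0 = 0 → (v : 𝔼 3) 1 = 0 → (∀ y : 𝕊², ⟪(y : 𝔼 3), (v : 𝔼 3)⟫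 < 0 → (∀ q, f q = y → Surjective (mfderiv (𝓡 4) (𝓡 2) f q)) ∧ Nonempty ((Fin (2 * 0) → ℤ) ≃ₗ[ℤ] singularHomology ℤ ℤ ↥(f ⁻¹' {y}) 1)) → (∀ y : 𝕊², ⟪(y : 𝔼 3), ((-v : 𝕊²) : 𝔼 3)⟫ < 0 → (∀ q, f q = y → Surjective (mfderiv (𝓡 4) (𝓡 2) f q)) ∧ Nonempty ((Fin (2 * (0 + 1)) → ℤ) ≃ₗ[ℤ] singularHomology ℤ ℤ ↥(f ⁻¹' {y}) 1)) → ∀ (e : Metric.sphere (0 : 𝔼 2) 1 → X) (ν₀ : CircleNbhd (𝓡 4) e), Set.range e = {p : X | ¬ Surjective (mfderiv (𝓡 4) (𝓡 2) f p)} \ (↑(∅ : Finset X) : Set X) → (∀ u, f (e u) = sphereInclusion 1 2 one_le_two u) → ∀ t₀ : ℝ, ∃ (c : ℝ) (P : 𝔼 3 →L[ℝ] 𝔼 3), c ≠ 0 ∧ Function.Injective P ∧ (∀ a b : 𝔼 3, fderiv ℝ (fderiv ℝ (fun q : ℝ × 𝔼 3 => SphereHeight.height (v : 𝔼 3) (f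 (ν₀.toFun (circlePt q.1, q.2))))) (t₀, 0) ((0 : ℝ), a) ((0 : ℝ), b) = c * (2 * ((P a) 0 * (P b) 0 + (P a) 1 * (P b) 1 - (P a) 2 * (P b) 2))) ∧ (t₀ = 0 → 0 < c) := by
  intro X _ _ _ _ _ _ o f hf hround v hv0 hv1 hlo hhi e ν₀ hrange hfe t₀
  set e₀ : EuclideanSpace ℝ (Fin 2) := EuclideanSpace.single (0 : Fin 2) (1 : ℝ) with he₀
  set e₁ : EuclideanSpace ℝ (Fin 2) := EuclideanSpace.single (1 : Fin 2) (1 : ℝ) with he₁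
  -- the tube map on the universal cover and the round base point
  set W : ℝ × 𝔼 3 → X := fun q => ν₀.toFun (circlePt q.1, q.2) with hW
  have hPms : ContMDiff 𝓘(ℝ, ℝ × 𝔼 3) ((𝓡 1).prod 𝓘(ℝ, 𝔼 3)) ∞
      fun q : ℝ × 𝔼 3 => ((circlePt q.1, q.2) : (Metric.sphere (0 : 𝔼 2) 1) × 𝔼 3) :=
    contMDiff_circlePt_prod
  have hWs : ContMDiff 𝓘(ℝ, ℝ × 𝔼 3) (𝓡 4) ∞ W := ν₀.isSmoothEmbedding.contMDiff.comp hPms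
  have hW0 : ∀ t : ℝ, W (t, 0) = e (circlePt t) := fun t => by simp [hW, ν₀.apply_zero]
  set q₀ : X := e (circlePt t₀) with hq₀def
  have hq₀Z : q₀ ∈ {p : X | ¬ Surjective (mfderiv (𝓡 4) (𝓡 2) f p)} \ (↑(∅ : Finset X) : Set X) :=
    hrange ▸ mem_range_self _
  obtain ⟨φ, ψ, hq, hq0, hmaps, hφ, hφs, hψ, hψs, hmodel⟩ :=
    hf.fold q₀ hq₀Z.1 (Finset.notMem_empty _)
  obtain ⟨hΓ, hS, hE, hinj, hΓ0⟩ :=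
    hf.sphereGerm_of_fold_chart hround hq hq0 hmaps hφ hφs hψ hψs hmodel
  set Γ : EuclideanSpace ℝ (Fin 2) → EuclideanSpace ℝ (Fin 3) :=
    fun w => ((ψ.symm w : 𝕊²) : 𝔼 3) with hΓdef
  -- the base height `Λ = ⟪v, ·⟫ ∘ ψ⁻¹` and its derivatives at `0`
  set Λ : EuclideanSpace ℝ (Fin 2) → ℝ := SphereHeight.height (v : 𝔼 3) ∘ ψ.symm with hΛdef
  have hΛΓ : Λ = (innerSL ℝ (v : 𝔼 3) : 𝔼 3 →L[ℝ] ℝ) ∘ Γ := height_comp_symm_eq ψ (v : 𝔼 3)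
  have hvin : ∀ w : 𝔼 3, ⟪(v : 𝔼 3), w⟫ = (v : 𝔼 3) 2 * w 2 := fun w => by
    rw [BandFoliation.inner_eq_three, hv0, hv1]; ring
  have hΓd : DifferentiableAt ℝ Γ 0 := hΓ.differentiableAt (by simp)
  have hΛ0 : fderiv ℝ Λ 0 e₀ = 0 := by
    rw [hΛΓ, fderiv_inner_comp_apply _ hΓd, hvin, SphereGerm.fderiv_single_zero_two hΓ hE, mul_zero]
  have hΛ00 : fderiv ℝ (fderiv ℝ Λ) 0 e₀ e₀ = 0 := by
    rw [hΛΓ, fderiv_fderiv_inner_comp_apply _ hΓ, hvin,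
      SphereGerm.fderiv_fderiv_single_zero_two hΓ hE, mul_zero]
  set lam : ℝ := fderiv ℝ Λ 0 e₁ with hlamdef
  have hlam : lam = (v : 𝔼 3) 2 * fderiv ℝ Γ 0 e₁ 2 := by
    rw [hlamdef, hΛΓ, fderiv_inner_comp_apply _ hΓd, hvin]
  have hv2 : (v : 𝔼 3) 2 ≠ 0 := by
    intro h0
    have h := norm_eq_of_mem_sphere v
    have h1 : ‖(v : 𝔼 3)‖ ^ 2 = 1 := by rw [h, one_pow]
    rw [← real_inner_self_eq_norm_sq, BandFoliation.inner_eq_three, hv0, hv1, h0] at h1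
    norm_num at h1
  have hlam0 : lam ≠ 0 := by
    rw [hlam]
    exact mul_ne_zero hv2 (fderiv_single_one_two_ne_zero hΓ hS hE hinj)
  -- `Λ` is `C^∞` at `0 = ψ (f q₀)`
  have hψ0 : ψ (f q₀) = 0 := base_apply_eq_zero_of_fold_chart hmodel hq hq0
  have h0t : (0 : EuclideanSpace ℝ (Fin 2)) ∈ ψ.target := hψ0 ▸ ψ.map_source (hmaps hq)
  have hΛs : ContDiffAt ℝ ∞ Λ 0 := contDiffAt_comp_symm_of_chart hψs (SphereHeight.contMDiff_height _) h0t
  -- `Λ ∘ N` at the axis point `0`: critical, with Hessian `lam · 2 (dx₁² + dx₂² - dx₃²)`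
  have hN0 : foldNF (0 : 𝔼 4) = 0 := by ext i; fin_cases i <;> simp
  have hax0 : (0 : 𝔼 4) 1 = 0 ∧ (0 : 𝔼 4) 2 = 0 ∧ (0 : 𝔼 4) 3 = 0 := by simp
  have hΛs2 : ContDiffAt ℝ 2 Λ (foldNF (0 : 𝔼 4)) := by rw [hN0]; exact hΛs.of_le (by norm_cast)
  have hΛN1 : fderiv ℝ (Λ ∘ foldNF) 0 = 0 := by
    ext w
    rw [fderiv_comp_foldNormalForm_apply (hΛs2.differentiableAt (by simp)) hax0 w, hN0, hΛ0,
      mul_zero, zero_apply]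
  have hΛN2 : ∀ p q : 𝔼 4, fderiv ℝ (fderiv ℝ (Λ ∘ foldNF)) 0 p q =
      lam * (2 * (p 1 * q 1 + p 2 * q 2 - p 3 * q 3)) := fun p q => by
    rw [fderiv_fderiv_comp_foldNormalForm_apply hΛs2 hax0 p q, hN0, hΛ00, zero_mul, zero_add]
  have hΛNs : ContDiffAt ℝ 2 (Λ ∘ foldNF) 0 :=
    hΛs2.comp 0 (contDiffAt_foldNormalForm_two 0)
  -- the chart reading `w = φ ∘ W` of the tube
  set w : ℝ × 𝔼 3 → 𝔼 4 := fun q => φ (W q) with hwdef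
  have hWq₀ : W (t₀, 0) = q₀ := hW0 t₀
  have hφat : ContMDiffAt (𝓡 4) (𝓡 4) ∞ φ q₀ := (hφ q₀ hq).contMDiffAt (φ.open_source.mem_nhds hq)
  have hws : ContMDiffAt 𝓘(ℝ, ℝ × 𝔼 3) 𝓘(ℝ, 𝔼 4) ∞ w (t₀, 0) :=
    ContMDiffAt.comp (t₀, 0) (by rw [hWq₀]; exact hφat) (hWs _)
  have hws' : ContDiffAt ℝ ∞ w (t₀, 0) := contMDiffAt_iff_contDiffAt.1 hws
  have hw0 : w (t₀, 0) = 0 := by simp only [hwdef, hWq₀, hq0]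
  -- `g = (Λ ∘ N) ∘ w` near `(t₀, 0)`
  have hev : (fun q : ℝ × 𝔼 3 => SphereHeight.height (v : 𝔼 3) (f (ν₀.toFun (circlePt q.1, q.2)))) =ᶠ[𝓝 (t₀, 0)]
      (Λ ∘ foldNF) ∘ w := by
    have hsrc : ∀ᶠ q in 𝓝 ((t₀, (0 : 𝔼 3)) : ℝ × 𝔼 3), W q ∈ φ.source :=
      (hWs _).continuousAt.preimage_mem_nhds (by rw [hWq₀]; exact φ.open_source.mem_nhds hq)
    filter_upwards [hsrc] with q hq'
    have h1 := comp_symm_eq_of_fold_chart (ℓ := SphereHeight.height (v : 𝔼 3)) hmaps hmodel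
      (φ.map_source hq')
    simp only [comp_apply, φ.left_inv hq'] at h1
    exact h1
  -- the Hessian through the second-order chain rule (the outer map is critical)
  have hD2 : ∀ V V' : ℝ × 𝔼 3,
      fderiv ℝ (fderiv ℝ (fun q : ℝ × 𝔼 3 =>
        SphereHeight.height (v : 𝔼 3) (f (ν₀.toFun (circlePt q.1, q.2))))) (t₀, 0) V V' =
      lam * (2 * ((fderiv ℝ w (t₀, 0) V) 1 * (fderiv ℝ w (t₀, 0) V') 1 +
        (fderiv ℝ w (t₀, 0) V) 2 * (fderiv ℝ w (t₀, 0) V') 2 -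
        (fderiv ℝ w (t₀, 0) V) 3 * (fderiv ℝ w (t₀, 0) V') 3)) := fun V V' => by
    rw [(hev.fderiv).fderiv_eq]
    have hΛNs' : ContDiffAt ℝ 2 (Λ ∘ foldNF) (w (t₀, 0)) := by rw [hw0]; exact hΛNs
    rw [fderiv_fderiv_comp_apply hΛNs' (hws'.of_le (by norm_cast)) V V', hw0, hΛN1,
      zero_apply, add_zero, hΛN2]
  -- the differential of `w` is injective and carries the parameter direction onto the axis
  set D : (ℝ × 𝔼 3) →L[ℝ] 𝔼 4 := fderiv ℝ w (t₀, 0) with hDdef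
  have hDinj : Injective D := by
    -- `w` has the smooth local left inverse `Pm⁻¹ ∘ ν₀⁻¹ ∘ φ⁻¹`; compute with `mfderiv`s
    have hn : (∞ : WithTop ℕ∞) ≠ 0 := by simp
    have h1 : Injective (mfderiv 𝓘(ℝ, ℝ × 𝔼 3) ((𝓡 1).prod 𝓘(ℝ, 𝔼 3))
        (fun q : ℝ × 𝔼 3 => ((circlePt q.1, q.2) : (Metric.sphere (0 : 𝔼 2) 1) × 𝔼 3)) (t₀, 0)) := by
      have hc : MDifferentiableAt 𝓘(ℝ, ℝ × 𝔼 3) (𝓡 1) (fun q : ℝ × 𝔼 3 => circlePt q.1) (t₀, 0) :=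
        ((contMDiff_circlePt.comp contDiff_fst.contMDiff) _).mdifferentiableAt hn
      have hs : MDifferentiableAt 𝓘(ℝ, ℝ × 𝔼 3) 𝓘(ℝ, 𝔼 3) (fun q : ℝ × 𝔼 3 => q.2) (t₀, 0) :=
        (contDiff_snd.contMDiff _).mdifferentiableAt hn
      rw [hc.mfderiv_prod hs]
      have hc' : mfderiv 𝓘(ℝ, ℝ × 𝔼 3) (𝓡 1) (fun q : ℝ × 𝔼 3 => circlePt q.1) (t₀, 0) =
          (mfderiv 𝓘(ℝ, ℝ) (𝓡 1) circlePt t₀).comp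
            (mfderiv 𝓘(ℝ, ℝ × 𝔼 3) 𝓘(ℝ, ℝ) (Prod.fst : ℝ × 𝔼 3 → ℝ) (t₀, 0)) :=
        mfderiv_comp (t₀, 0) (contMDiff_circlePt.contMDiffAt.mdifferentiableAt hn)
          ((contDiff_fst.contMDiff _).mdifferentiableAt hn)
      have hfst : mfderiv 𝓘(ℝ, ℝ × 𝔼 3) 𝓘(ℝ, ℝ) (Prod.fst : ℝ × 𝔼 3 → ℝ) (t₀, 0) =
          ContinuousLinearMap.fst ℝ ℝ (𝔼 3) := by
        rw [mfderiv_eq_fderiv]; exact fderiv_fst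
      have hsnd : mfderiv 𝓘(ℝ, ℝ × 𝔼 3) 𝓘(ℝ, 𝔼 3) (fun q : ℝ × 𝔼 3 => q.2) (t₀, 0) =
          ContinuousLinearMap.snd ℝ ℝ (𝔼 3) := by
        rw [mfderiv_eq_fderiv]; exact fderiv_snd
      intro V V' hV
      rw [hc', hsnd] at hV
      have h1 := congrArg Prod.fst hV
      have h2 := congrArg Prod.snd hV
      simp only [hfst] at h1 h2
      exact Prod.ext (mfderiv_circlePt_injective t₀ h1) h2
    have h2 : Injective (mfderiv ((𝓡 1).prod 𝓘(ℝ, 𝔼 3)) (𝓡 4) ν₀.toFun (circlePt t₀, 0)) := by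
      refine mfderiv_injective_of_leftInverse (ν₀.contMDiff _)
        (ν₀.contMDiffOn_toHomeo_symm.contMDiffAt (ν₀.isOpen_range.mem_nhds ⟨_, rfl⟩)) ?_
      exact Eventually.of_forall fun q => ν₀.toHomeo_symm_apply q
    have h3 : Injective (mfderiv (𝓡 4) (𝓡 4) φ q₀) := by
      refine mfderiv_injective_of_leftInverse hφat
        ((hφs _ (φ.map_source hq)).contMDiffAt (φ.open_target.mem_nhds (φ.map_source hq))) ?_
      exact φ.eventually_left_inverse hq
    have hWd : mfderiv 𝓘(ℝ, ℝ × 𝔼 3) (𝓡 4) W (t₀, 0) =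
        (mfderiv ((𝓡 1).prod 𝓘(ℝ, 𝔼 3)) (𝓡 4) ν₀.toFun (circlePt t₀, 0)).comp
          (mfderiv 𝓘(ℝ, ℝ × 𝔼 3) ((𝓡 1).prod 𝓘(ℝ, 𝔼 3))
            (fun q : ℝ × 𝔼 3 => ((circlePt q.1, q.2) : (Metric.sphere (0 : 𝔼 2) 1) × 𝔼 3)) (t₀, 0)) :=
      mfderiv_comp (t₀, 0) ((ν₀.contMDiff _).mdifferentiableAt hn) ((hPms _).mdifferentiableAt hn)
    have hφd : MDifferentiableAt (𝓡 4) (𝓡 4) φ (W (t₀, 0)) := hWq₀ ▸ hφat.mdifferentiableAt hn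
    have hwd : mfderiv 𝓘(ℝ, ℝ × 𝔼 3) (𝓡 4) w (t₀, 0) =
        (mfderiv (𝓡 4) (𝓡 4) φ q₀).comp (mfderiv 𝓘(ℝ, ℝ × 𝔼 3) (𝓡 4) W (t₀, 0)) := by
      rw [hq₀def, ← hW0 t₀]
      exact mfderiv_comp (t₀, 0) hφd ((hWs _).mdifferentiableAt hn)
    have hDm : D = mfderiv 𝓘(ℝ, ℝ × 𝔼 3) (𝓡 4) w (t₀, 0) := by rw [hDdef, ← mfderiv_eq_fderiv]
    rw [hDm, hwd, hWd]
    exact h3.comp (h2.comp h1)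
  have haxis : ∀ (τ : ℝ) (i : Fin 3), D (τ, 0) i.succ = 0 := by
    -- the zero section goes to the axis of the chart
    have hsrc : ∀ᶠ s in 𝓝 t₀, W (s, 0) ∈ φ.source := by
      have hc : Continuous fun s : ℝ => W (s, 0) := (hWs.continuous).comp (by fun_prop)
      exact hc.continuousAt.preimage_mem_nhds (by rw [hWq₀]; exact φ.open_source.mem_nhds hq)
    have hax : ∀ i : Fin 3, ∀ᶠ s in 𝓝 t₀, w (s, 0) i.succ = 0 := fun i => by
      filter_upwards [hsrc] with s hs
      have hmem : e (circlePt s) ∈ {p : X | ¬ Surjective (mfderiv (𝓡 4) (𝓡 2) f p)} \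
          (↑(∅ : Finset X) : Set X) := hrange ▸ mem_range_self _
      have hround' : ¬ Surjective (mfderiv (𝓡 4) (𝓡 2) f (W (s, 0))) := by
        rw [hW0 s]
        exact hmem.1
      have hfd : MDifferentiableAt (𝓡 4) (𝓡 2) f (W (s, 0)) :=
        (hf.contMDiff _).mdifferentiableAt (by simp)
      have key : (φ (W (s, 0))) 1 = 0 ∧ (φ (W (s, 0))) 2 = 0 ∧ (φ (W (s, 0))) 3 = 0 := by
        by_contra hne
        exact hround' ((surjective_mfderiv_iff_of_fold_chart hmaps (hφ.of_le (by norm_cast))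
          (hφs.of_le (by norm_cast)) (hψ.of_le (by norm_cast)) (hψs.of_le (by norm_cast)) hmodel hs
          hfd).2 hne)
      fin_cases i
      · exact key.1
      · exact key.2.1
      · exact key.2.2
    intro τ i
    have hwd : DifferentiableAt ℝ w (t₀, 0) := hws'.differentiableAt (by simp)
    -- the coordinate `i.succ` of `s ↦ w (s, 0)` is constant near `t₀`
    have h1 : HasDerivAt (fun s : ℝ => w (s, 0) i.succ) (D (1, 0) i.succ) t₀ := by
      have hl : HasDerivAt (fun s : ℝ => ((s, (0 : 𝔼 3)) : ℝ × 𝔼 3)) ((1 : ℝ), (0 : 𝔼 3)) t₀ :=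
        (hasDerivAt_id t₀).prodMk (hasDerivAt_const t₀ (0 : 𝔼 3))
      have h := (hwd.hasFDerivAt.comp_hasDerivAt t₀ hl)
      exact (EuclideanSpace.proj (𝕜 := ℝ) i.succ).hasFDerivAt.comp_hasDerivAt t₀ h
    have h2 : HasDerivAt (fun s : ℝ => w (s, 0) i.succ) 0 t₀ :=
      (hasDerivAt_const t₀ (0 : ℝ)).congr_of_eventuallyEq (hax i)
    have h10 : D (1, 0) i.succ = 0 := h1.unique h2
    have hsm : ((τ : ℝ), (0 : 𝔼 3)) = τ • ((1 : ℝ), (0 : 𝔼 3)) := by simp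
    rw [hsm, map_smul, PiLp.smul_apply, h10, smul_zero]
  -- conclusion
  set P : 𝔼 3 →L[ℝ] 𝔼 3 := fibrePart.comp (D.comp (ContinuousLinearMap.inr ℝ ℝ (𝔼 3))) with hPdef
  have hP : ∀ (a : 𝔼 3) (i : Fin 3), P a i = D ((0 : ℝ), a) i.succ := fun a i => by
    simp [hPdef, fibrePart_apply]
  refine ⟨lam, P, hlam0, injective_fibrePart_comp_inr hDinj haxis, fun a b => ?_, fun ht₀ => ?_⟩
  · rw [hD2]
    simp only [hP]
    rfl
  · -- at `t₀ = 0` the chart is centred at a round point of the meridian slice: `lam > 0`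
    have hx1 : ((f q₀ : 𝕊²) : 𝔼 3) 1 = 0 := by
      rw [hq₀def, hfe, ht₀, (coe_sphereInclusion_circlePt 0).2.1]
      simp
    have := mul_fderiv_symm_pos_of_fold_chart hf hround hv0 hv1 hlo hhi hx1 hq hq0 hmaps hφ hφs
      hψ hψs hmodel
    rw [hlam]
    exact this

end Summit.SmoothPoincare4.SmoothPoincare4.Cruxes.RungOne.Sketch

end
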